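import Summits.BirchSwinnertonDyer.BirchSwinnertonDyer.Theorems.AdditiveKolyvaginRoadKummerDescentTransfer
import Summits.BirchSwinnertonDyer.BirchSwinnertonDyer.Theorems.AdditiveKolyvaginRoadLevelKolyvaginSystemsAdditiveSplitCompletion
import Literature.NumberTheory.Automorphic.AdicCompletionDegreeOnePlaceProofs
import HarnessLib

/-!
# Route `AdditiveKolyvaginRoad`, crux `LevelKolyvaginSystemsAdditive` (item stmt-BirchSwinnertonDyer-21396, KS′):
# DESCENT `ℚ_u ↝ K_v` OF AN IDENTITY OF LOCAL KUMMER CONDITIONS AT A PRIME OF DEGREE ONE — brick B2c of the K-half of stub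
# `stub_kummerLineAtP` of line `epsilon_matched_retyping` (cell `pub/bsd-wall`, width seat `bsd-wall-akr-p2x-w2` g4;
# `--supports stmt-BirchSwinnertonDyer-21396`, helper; namespace `…Theorems.AdditiveKoly.KummerDescent`)

WHY. Stub S4 `stub_kummerLineAtP`: at a prime `v ∣ p` of the Heegner field `K` with `p` split, a GLOBAL class `y ∈ H¹(K, E₀[p])`
satisfies E₀'s local Selmer condition at `K_v` iff `θ_* y` satisfies E's (`θ : E₀[p](K̄) ≃ E[p](K̄)` the transferred torsion
isomorphism). Bricks B2a/B2b (`…KummerDescentBaseField`, `…KummerDescentTransfer`) move an identity `φ_* 𝓚_E(E₀) = 𝓚_E(E)` of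
local Kummer conditions of the ℚ-curves at a ℚ-field `E` to the `K`-curves at the SAME field `E`, once `E` is also a `K`-field
over the tower `ℚ ⊆ K`. THIS file supplies the field: for `v` of degree one over `u = v ∩ ℚ` the completion `ℚ_u` IS a
`K`-field — through the ring isomorphism `ℚ_u ≃ K_v` of the tree (`exists_ringEquiv_adicCompletion_of_ramificationIdx_eq_one_of_inertiaDeg_eq_one`)
— isomorphic to `K_v` as a `K`-algebra; and the Selmer local kernel `selmerLocalKer X E n ≤ H¹(K, X[n])` sees only the
`K`-algebra class of the local field `E` (`selmerLocalKer_le_of_tower` both ways). So the identity at `ℚ_u` (w2 g3's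
`LagrangianSwitchAtP.map_kummer_eq_kummer_rat_of_p_parity`, p601209, stated on `Place.Completion (Sum.inr u)`) descends to the
global-class statement at `K_v` that the transfer socket consumes — with NO comparison of absolute Galois groups.

WHAT (namespace `…Theorems.AdditiveKoly.KummerDescent`).
* §1 `selmerLocalKer_eq_of_ringEquiv` — a `K`-field `E` and a field `E'` carrying a ring isomorphism `E ≃+* E'`, made a
  `K`-algebra through it: `selmerLocalKer X E n = selmerLocalKer X E' n`.
* §2 **`h1Equiv_torsionTransfer_mem_selmerLocalKer_iff_of_map_kummer_eq`** — `W, W₀` elliptic over `ℚ`, `[K : ℚ] = 2`, `p` with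
  two primes of `𝓞 K` above it, `v ∋ p`, `e : W₀[n] ≃ W[n]` `Γ_ℚ`-equivariant (`n = p¹`) with an intertwining map `φ = e`,
  and the ℚ-level identity `φ_* 𝓚_u(W₀) = 𝓚_u(W)` at `u = v ∩ ℚ`: then for every `y ∈ H¹(K, (W₀ ⊗ K)[n])`,
  `h1Equiv θ y ∈ selmerLocalKer (W ⊗ K) K_v n ↔ y ∈ selmerLocalKer (W₀ ⊗ K) K_v n`, `θ = T_W ∘ e ∘ T_{W₀}⁻¹`.

HONEST FRAMING: theorems only; 0 definitions, 0 named facts, 0 `sorry`. The K-half of (θK)ₚ for the CANONICAL transferred `θ`;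
the sequel plugs in the ℚ-half (p601209) and the uniqueness of `θ` up to scalars. BSD is not proved by any of this.

References: [cite: CasselsFrohlichANT1967, Ch. II §10 Theorem (10.2)] [cite: SerreGaloisCohomology1997, I §2.4, II §1.1]
[cite: SilvermanAEC2009, X.§4] [cite: MilneADT2006, Ch. I §6].
-/

-- single-conjunct summit: `Summit.BirchSwinnertonDyer.BirchSwinnertonDyer.…` repeats the name by design
set_option linter.dupNamespace false
set_option autoImplicit false

noncomputable section

open scoped Classical NumberField

namespace Summit.BirchSwinnertonDyer.BirchSwinnertonDyer.Theorems.AdditiveKoly.KummerDescent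

open WeierstrassCurve Field NumberField IsDedekindDomain
  Literature.NumberTheory.EllipticCurves Literature.NumberTheory.GaloisRepresentations
open scoped ContRepresentation

/-! ## §1 The Selmer local kernel sees only the `K`-algebra class of the local field -/

section RingEquiv

variable {K : Type} [Field K] (X : WeierstrassCurve K) (n : ℤ)
  (E : Type) [Field E] [Algebra K E] (E' : Type) [Field E']

/-- **`selmerLocalKer X E n = selmerLocalKer X E' n` for `K`-isomorphic local fields.** If `E'` is made a `K`-algebra
through a ring isomorphism `ψ : E ≃+* E'` (`algebraMap K E' = ψ ∘ algebraMap K E`), then the local Selmer kernels of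
`H¹(K, X[n])` at `E` and at `E'` coincide: each field is an algebra over the other compatibly with `K`, and the local kernel
grows along towers (`selmerLocalKer_le_of_tower`). [cite: SerreGaloisCohomology1997, II §1.1] [cite: SilvermanAEC2009, X.§4] -/
theorem selmerLocalKer_eq_of_ringEquiv (ψ : E ≃+* E') (algKE' : Algebra K E')
    (halg : ∀ x : K, @algebraMap K E' _ _ algKE' x = ψ (algebraMap K E x)) :
    selmerLocalKer X E n = @selmerLocalKer K _ X E' _ algKE' n := by
  letI : Algebra K E' := algKE'
  apply le_antisymm
  · letI : Algebra E E' := ψ.toRingHom.toAlgebra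
    haveI : IsScalarTower K E E' := IsScalarTower.of_algebraMap_eq fun x ↦ halg x
    exact selmerLocalKer_le_of_tower X n
  · letI : Algebra E' E := ψ.symm.toRingHom.toAlgebra
    haveI : IsScalarTower K E' E := IsScalarTower.of_algebraMap_eq fun x ↦ by
      change algebraMap K E x = ψ.symm (algebraMap K E' x)
      rw [halg, RingEquiv.symm_apply_apply]
    exact selmerLocalKer_le_of_tower X n

end RingEquiv

/-! ## §2 The descent at a prime of degree one -/

section Split

variable (W W₀ : WeierstrassCurve ℚ) [W.IsElliptic] [W₀.IsElliptic] (p : ℕ) [Fact p.Prime]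
  (K : Type) [Field K] [NumberField K]

/-- **THE K-HALF OF (θK)ₚ FOR THE TRANSFERRED TORSION ISOMORPHISM.** `W, W₀` elliptic curves over `ℚ`, `K` quadratic with two
primes above `p` (`hsplit`), `v ∋ p` one of them, `u = v ∩ 𝓞 ℚ`; `e : W₀[n](ℚ̄) ≃ W[n](ℚ̄)` `Γ_ℚ`-equivariant (`n = p¹`), `φ` its
intertwining map, and ASSUME the ℚ-level identity of local Kummer conditions at `u`: `φ_{u,*} 𝓚_u(W₀) = 𝓚_u(W)` in `H¹(ℚ_u, W[n])`
(Selmer-structure currency, `Place.Completion (Sum.inr u)`). THEN for the transferred `Γ_K`-isomorphism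
`θ = T_W ∘ e ∘ T_{W₀}⁻¹ : (W₀ ⊗ K)[n](K̄) ≃ (W ⊗ K)[n](K̄)` and every global class `y ∈ H¹(K, (W₀ ⊗ K)[n])`:
`h1Equiv θ y ∈ selmerLocalKer (W ⊗ K) K_v n ↔ y ∈ selmerLocalKer (W₀ ⊗ K) K_v n`.
Road: `e(v|u) = f(v|u) = 1` (split-completion brick) ⟹ a ring isomorphism `ℚ_u ≃ K_v` over `ℚ_u → K_v`, through which `ℚ_u`
becomes a `K`-field isomorphic to `K_v` (§1: same Selmer local kernels), over the tower `ℚ ⊆ K` (ring maps out of `ℚ` are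
unique); at the `K`-field `ℚ_u` bricks B2a/B2b turn the ℚ-level identity into `θ_* 𝓚(W₀ ⊗ K) = 𝓚(W ⊗ K)` and then into the
global-class statement. [cite: CasselsFrohlichANT1967, Ch. II §10 Theorem (10.2)] [cite: SerreGaloisCohomology1997, I §2.4]
[cite: SilvermanAEC2009, X.§4] -/
theorem h1Equiv_torsionTransfer_mem_selmerLocalKer_iff_of_map_kummer_eq
    (hK2 : Module.finrank ℚ K = 2) (hsplit : ((Ideal.span {(p : ℤ)}).primesOver (𝓞 K)).ncard = 2)
    (hn : ((p ^ 1 : ℕ) : ℤ) ≠ 0)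
    (e : geomTorsion W₀ ((p ^ 1 : ℕ) : ℤ) ≃+ geomTorsion W ((p ^ 1 : ℕ) : ℤ))
    (he : ∀ (σ : absoluteGaloisGroup ℚ) (P : geomTorsion W₀ ((p ^ 1 : ℕ) : ℤ)), e (σ • P) = σ • e P)
    (φ : (W₀.torsionGaloisModule ((p ^ 1 : ℕ) : ℤ)).toContRepresentation →ⁱL
      (W.torsionGaloisModule ((p ^ 1 : ℕ) : ℤ)).toContRepresentation)
    (hφ : ∀ a, φ a = e a)
    (v : HeightOneSpectrum (𝓞 K)) (hvp : ((p : ℕ) : 𝓞 K) ∈ v.asIdeal)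
    (hrat : (W₀.kummerSelmerStructure ((p ^ 1 : ℕ) : ℤ) (Sum.inr (v.under (𝓞 ℚ)))).map
        (galoisCohomology.map (φ.restrictField (Place.Completion (Sum.inr (v.under (𝓞 ℚ)) : Place ℚ))) 1) =
      W.kummerSelmerStructure ((p ^ 1 : ℕ) : ℤ) (Sum.inr (v.under (𝓞 ℚ))))
    (y : galH1Torsion (W₀.baseChange K) ((p ^ 1 : ℕ) : ℤ)) :
    h1Equiv
        (((W₀.torsionTransferEquiv (E := K) hn).symm.trans e).trans (W.torsionTransferEquiv (E := K) hn))
        (torsionTransfer_conj_smul W W₀ hn e he) y ∈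
        selmerLocalKer (W.baseChange K) (v.adicCompletion K) ((p ^ 1 : ℕ) : ℤ) ↔
      y ∈ selmerLocalKer (W₀.baseChange K) (v.adicCompletion K) ((p ^ 1 : ℕ) : ℤ) := by
  haveI : (W.baseChange K).IsElliptic := inferInstanceAs (W.map (algebraMap ℚ K)).IsElliptic
  haveI : (W₀.baseChange K).IsElliptic := inferInstanceAs (W₀.map (algebraMap ℚ K)).IsElliptic
  -- the place `u` of `ℚ` under `v`; `v` has degree one over it
  set u : HeightOneSpectrum (𝓞 ℚ) := v.under (𝓞 ℚ) with hu
  have he1 : v.asIdeal.ramificationIdx (𝓞 ℚ) = 1 := SplitCompletion.ramificationIdx_eq_one_of_card_primesOver K p hK2 hsplit v hvp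
  have hf1 : v.asIdeal.inertiaDeg (𝓞 ℚ) = 1 := SplitCompletion.inertiaDeg_eq_one_of_card_primesOver K p hK2 hsplit v hvp
  haveI : v.asIdeal.LiesOver u.asIdeal := by rw [hu, HeightOneSpectrum.under_asIdeal]; infer_instance
  obtain ⟨-, φc, -, -⟩ :=
    Literature.NumberTheory.Automorphic.exists_ringEquiv_adicCompletion_of_ramificationIdx_eq_one_of_inertiaDeg_eq_one
      ℚ K u v he1 hf1
  -- `ℚ_u` as a `K`-field through `φc : ℚ_u ≃ K_v`, over the tower `ℚ ⊆ K`
  let E : Type := Place.Completion (Sum.inr u : Place ℚ)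
  let ψ : v.adicCompletion K ≃+* E := φc.symm
  letI algKE : Algebra K E := (ψ.toRingHom.comp (algebraMap K (v.adicCompletion K))).toAlgebra
  have halg : ∀ x : K, algebraMap K E x = ψ (algebraMap K (v.adicCompletion K) x) := fun x ↦ rfl
  haveI : IsScalarTower ℚ K E := IsScalarTower.of_algebraMap_eq fun x ↦ by
    have hsub : (algebraMap K E).comp (algebraMap ℚ K) = algebraMap ℚ E := Subsingleton.elim _ _
    exact (RingHom.congr_fun hsub x).symm
  -- the Selmer local kernels at `K_v` are those at the `K`-field `ℚ_u`
  rw [selmerLocalKer_eq_of_ringEquiv (W.baseChange K) _ (v.adicCompletion K) E ψ algKE halg,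
    selmerLocalKer_eq_of_ringEquiv (W₀.baseChange K) _ (v.adicCompletion K) E ψ algKE halg]
  -- the intertwining map of `θ` over `K`
  obtain ⟨φK, -, hφK, -, -, -, -⟩ := exists_intertwining_of_addEquiv (W.baseChange K) (W₀.baseChange K)
    ((p ^ 1 : ℕ) : ℤ) (((W₀.torsionTransferEquiv (E := K) hn).symm.trans e).trans (W.torsionTransferEquiv (E := K) hn))
    (torsionTransfer_conj_smul W W₀ hn e he)
  -- the ℚ-level identity at `ℚ_u`, transferred to the `K`-curves at the `K`-field `ℚ_u`
  have hF : (W₀.kummerLocalConditionAt ((p ^ 1 : ℕ) : ℤ) E).map (galoisCohomology.map (φ.restrictField E) 1) =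
      W.kummerLocalConditionAt ((p ^ 1 : ℕ) : ℤ) E := hrat
  have hloc := map_kummerLocalConditionAt_baseChange_of_map_eq (F := ℚ) (K := K) W W₀ hn e he E φ hφ φK
    (fun b ↦ hφK b) hF
  exact h1Equiv_mem_selmerLocalKer_iff_of_map_kummerLocalConditionAt_eq (W.baseChange K) (W₀.baseChange K)
    ((p ^ 1 : ℕ) : ℤ) _ (torsionTransfer_conj_smul W W₀ hn e he) E φK hφK hloc y

end Split

end Summit.BirchSwinnertonDyer.BirchSwinnertonDyer.Theorems.AdditiveKoly.KummerDescent

end
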